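/-
Copyright: harness tree, Literature layer (sorry-free). b2b-lace enum1-g53 (ENUMERATION SHARD A gen 53),
node KU-SEP-DHAT-SHIFT: the `D̂ Ĉ = Ĉ − 1` order shift of the twisted moments and the elimination of the
odd cosine classes of the `KM₂` weight.
-/
import Literature.Probability.FitznerVanDerHofstad2017.SrwTwistWeightClasses
import Literature.Probability.FitznerVanDerHofstad2017.SrwChatPowSchwinger
import HarnessLib

/-!
# The `D̂ Ĉ = Ĉ − 1` shift of twisted moments; elimination of the odd cosine classes

CITATION HEADER (PLACEMENT v2). Part of the certified REPRODUCTION of the numerical inputs of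
R. Fitzner, R. van der Hofstad, *Generalized approach to the non-backtracking lace expansion*,
Probab. Theory Related Fields 169 (2017) 1041–1119 [NoBLE17-I] (arXiv:1506.07969), §3.3.3 and §5.2
((3.34)–(3.38) p. 1071; (5.9), (5.14) p. 1092), as consumed by *Mean-field behavior for
nearest-neighbor percolation in `d > 10`*, Electron. J. Probab. 22 (2017) no. 43 [FvdH17].
Origin: build `lace`, unit `b2b-lace-enum1-g53` (KU-SEP twisted-seed lane; what-if / input-certification
support).  d-generic, number-free, definition-free: nothing here is a statement about percolation,
nothing is evaluated at a specific `d`, nothing is a certificate.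

## What is proved, and why

The twisted moments `Tw^w_n(x;β) = ∫ w cos(β D̂^{(x)}) Ĉⁿ dk/(2π)^d` (`srwTwist`) of the KU-SEP chain are
certified class by class (`SrwTwistWeightClasses`; the product-row certificates `SrwTwistProdCertKernel`
take class lists with `Σ_r p_r a_r` EVEN — the Poisson layer of that kernel is written for even
exponents).  The `KM₂` weight `|D̂|⁰ M̂²`, `M̂ = D̂ − 2 D̂^{sin} Ĉ` (§3.3.3), produces at the shifted
Schwinger order `n+1` the moment `Tw^{D̂ D̂^{sin}}_{n+1}`, whose pure cosine classes `[1] = cos k_i`,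
`[3] = cos³ k_i`, `[1,2] = cos k_i cos² k_{i'}` have ODD total degree
(`srwTwist_abs_Dhat_pow_zero_mul_Mhat_sq_eq_classes`).  They are eliminated exactly by one observation:
off the null set `{D̂ = 1}` the propagator is a genuine inverse, `D̂ Ĉ = Ĉ − 1`, so a factor `D̂` in the
weight is a DIFFERENCE OF SCHWINGER ORDERS; and `D̂^{(x)}` is permutation symmetric for every node `x`
(`srwTwist_mul_Dhat_eq_class`, `srwTwist_mul_Dhat_eq_marked`), so a single `cos k_i` against a symmetric
co-factor is a `D̂`.

* `Dhat_mul_Chat_ae_eq` — `D̂ Ĉ = Ĉ − 1` for `P d`-a.e. `k` (`ae_Dhat_lt_one`);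
* **`srwTwist_mul_Dhat_succ_eq_sub`** — for every bounded measurable weight `w`, every node `x`, every
  `β` and `d ≥ 2n+3`:  `Tw^{w·D̂}_{n+1}(x;β) = Tw^{w}_{n+1}(x;β) − Tw^{w}_n(x;β)`;
* `srwTwist_cos_succ_eq_sub` — `[1]ₙ₊₁ = [0]ₙ₊₁ − [0]ₙ`: `Tw^{cos k_i}_{n+1} = Tw^{1}_{n+1} − Tw^{1}_n`;
* `srwTwist_cos_pow_three_add_eq` — `[3]ₙ₊₁ + (d−1)·[1,2]ₙ₊₁ = d·([2]ₙ₊₁ − [2]ₙ)`;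
* `srwTwist_Dhat_mul_Dsin_succ_eq_sub` — `Tw^{D̂ D̂^{sin}}_{n+1} = d⁻¹ (([0]−[2])ₙ₊₁ − ([0]−[2])ₙ)`;
* **`srwTwist_abs_Dhat_pow_zero_mul_Mhat_sq_eq_even`** / **`srwTwist_abs_Dhat_pow_zero_mul_Mhat_sq_encl_even`**
  — the `KM₂` weight as an exact signed combination of, and a two-sided enclosure from, the nine EVEN
  inputs `[0]ₙ, [2]ₙ, [1,1]ₙ, [0]ₙ₊₁, [2]ₙ₊₁, [0]ₙ₊₂, [2]ₙ₊₂, [4]ₙ₊₂, [2,2]ₙ₊₂` (representatives `1`,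
  `cos² k_i`, `cos k_i cos k_{i'}`, `cos⁴ k_i`, `cos² k_i cos² k_{i'}`, `i ≠ i'`).

Hence the `KM₂` rows of the trigonometric-majorant chain (`SrwTrigMajorantEncl`) are fed by the
weight-`1` twisted seeds (`[0]`), the `K_{n,2}` classes (`[2]`, `[1,1]`) and the two even classes `[4]`,
`[2,2]` only.  All statements are exact identities / monotone bookkeeping for general `d`.

## References
* [NoBLE17-I] R. Fitzner, R. van der Hofstad, PTRF 169 (2017) 1041–1119; arXiv:1506.07969 — §3.3.3
  p. 1070 (`M̂`, `D̂^{sin}`), (3.34)–(3.38) p. 1071, §5.1.1 (5.2)–(5.5) pp. 1089–1090, §5.2 (5.9), (5.14)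
  p. 1092.
* [HvdH17] M. Heydenreich, R. van der Hofstad, *Progress in high-dimensional percolation and random
  graphs*, Springer 2017 — (5.1.11) (`D̂ < 1` almost everywhere).
* [FvdH17] R. Fitzner, R. van der Hofstad, EJP 22 (2017) no. 43; arXiv:1506.07977 — consumer of the tables.
-/

noncomputable section

open MeasureTheory Real Finset
open scoped BigOperators

namespace Literature.Probability.FitznerVanDerHofstad2017

open Literature.Barriers.CriticalPhenomena
open Literature.Barriers.CriticalPhenomena.Slade2006Prop53 (P)

variable {d : ℕ}

/-! ### `D̂ Ĉ = Ĉ − 1` almost everywhere -/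

/-- `D̂(k) Ĉ(k) = Ĉ(k) − 1` for `P d`-a.e. `k`: off the null set `{D̂ = 1}` the propagator
`Ĉ = [1 − D̂]⁻¹` is a genuine inverse. [cite: HeydenreichVanDerHofstad2017, (5.1.11)] -/
theorem Dhat_mul_Chat_ae_eq : ∀ᵐ k ∂P d, Dhat d k * Chat d 1 k = Chat d 1 k - 1 := by
  filter_upwards [ae_Dhat_lt_one] with k hk
  have h1 : (1 : ℝ) - Dhat d k ≠ 0 := (sub_pos.mpr hk).ne'
  have hC : Chat d 1 k = (1 - Dhat d k)⁻¹ := by simp only [Chat, one_mul, one_div]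
  rw [hC]
  calc Dhat d k * (1 - Dhat d k)⁻¹
      = (1 - (1 - Dhat d k)) * (1 - Dhat d k)⁻¹ := by ring
    _ = (1 - Dhat d k)⁻¹ - 1 := by rw [sub_mul, one_mul, mul_inv_cancel₀ h1]

/-! ### The order shift -/

/-- **The `D̂ Ĉ = Ĉ − 1` shift.** For a bounded measurable weight `w`, every node `x`, every `β` and
`d ≥ 2(n+1)+1`: `Tw^{w·D̂}_{n+1}(x;β) = Tw^{w}_{n+1}(x;β) − Tw^{w}_n(x;β)` — a factor `D̂` in the weight
is a difference of Schwinger orders. [cite: FitznerVanDerHofstad2016NoBLE, (3.34) p. 1071, §5.1.1 (5.5) p. 1090] -/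
theorem srwTwist_mul_Dhat_succ_eq_sub {n : ℕ} (hd : 2 * (n + 1) + 1 ≤ d) (w : (Fin d → ℝ) → ℝ)
    (hw : Measurable w) {W : ℝ} (hw1 : ∀ k, |w k| ≤ W) (x : Fin d → ℤ) (β : ℝ) :
    srwTwist d (n + 1) (fun k => w k * Dhat d k) x β
      = srwTwist d (n + 1) w x β - srwTwist d n w x β := by
  have hae : (fun k => ((w k * Dhat d k) * Real.cos (β * DhatSym d x k)) * Chat d 1 k ^ (n + 1))
      =ᵐ[P d] fun k => (w k * Real.cos (β * DhatSym d x k)) * Chat d 1 k ^ (n + 1)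
        - (w k * Real.cos (β * DhatSym d x k)) * Chat d 1 k ^ n := by
    filter_upwards [Dhat_mul_Chat_ae_eq] with k hk
    rw [show ((w k * Dhat d k) * Real.cos (β * DhatSym d x k)) * Chat d 1 k ^ (n + 1)
        = ((w k * Real.cos (β * DhatSym d x k)) * Chat d 1 k ^ n) * (Dhat d k * Chat d 1 k) by ring, hk]
    ring
  simp only [srwTwist]
  rw [← sub_div, ← integral_sub (integrable_weight_cos_mul_Chat_pow hd hw hw1 x β)
    (integrable_weight_cos_mul_Chat_pow (by omega : 2 * n + 1 ≤ d) hw hw1 x β)]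
  congr 1
  exact integral_congr_ae hae

/-- `Tw^{D̂}_{n+1}(x;β) = Tw^{1}_{n+1}(x;β) − Tw^{1}_n(x;β)` (`d ≥ 2(n+1)+1`).
[cite: FitznerVanDerHofstad2016NoBLE, (3.34) p. 1071, §5.1.1 (5.5) p. 1090] -/
theorem srwTwist_Dhat_succ_eq_sub {n : ℕ} (hd : 2 * (n + 1) + 1 ≤ d) (x : Fin d → ℤ) (β : ℝ) :
    srwTwist d (n + 1) (Dhat d) x β
      = srwTwist d (n + 1) (fun _ => (1 : ℝ)) x β - srwTwist d n (fun _ => (1 : ℝ)) x β := by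
  have h : srwTwist d (n + 1) (fun k => (1 : ℝ) * Dhat d k) x β
      = srwTwist d (n + 1) (fun _ => (1 : ℝ)) x β - srwTwist d n (fun _ => (1 : ℝ)) x β :=
    srwTwist_mul_Dhat_succ_eq_sub hd (fun _ => (1 : ℝ)) measurable_const (W := 1)
      (fun _ => by rw [abs_one]) x β
  rw [← h]
  exact congrArg (fun w => srwTwist d (n + 1) w x β) (funext fun k => (one_mul _).symm)

/-! ### Elimination of the odd classes -/

/-- **`[1]ₙ₊₁ = [0]ₙ₊₁ − [0]ₙ`:** `Tw^{cos k_i}_{n+1}(x;β) = Tw^{1}_{n+1}(x;β) − Tw^{1}_n(x;β)` for every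
axis `i`, every node `x`, every `β` (`d ≥ 2(n+1)+1`; `D̂^{(x)}` is permutation symmetric, so the `d` seeds
`cos k_j` form one class `= D̂`). [cite: FitznerVanDerHofstad2016NoBLE, (3.34)–(3.36) p. 1071, §5.1.1 (5.5) p. 1090] -/
theorem srwTwist_cos_succ_eq_sub {n : ℕ} (hd : 2 * (n + 1) + 1 ≤ d) (i : Fin d) (x : Fin d → ℤ)
    (β : ℝ) :
    srwTwist d (n + 1) (fun k => Real.cos (k i)) x β
      = srwTwist d (n + 1) (fun _ => (1 : ℝ)) x β - srwTwist d n (fun _ => (1 : ℝ)) x β := by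
  have h1 : srwTwist d (n + 1) (fun k => (1 : ℝ) * Dhat d k) x β
      = srwTwist d (n + 1) (fun k => (1 : ℝ) * Real.cos (k i)) x β :=
    srwTwist_mul_Dhat_eq_class hd (fun _ => (1 : ℝ)) measurable_const (U := 1)
      (fun _ => by rw [abs_one]) (fun _ _ => rfl) i x β
  have h2 : srwTwist d (n + 1) (fun k => (1 : ℝ) * Dhat d k) x β
      = srwTwist d (n + 1) (fun _ => (1 : ℝ)) x β - srwTwist d n (fun _ => (1 : ℝ)) x β :=
    srwTwist_mul_Dhat_succ_eq_sub hd (fun _ => (1 : ℝ)) measurable_const (W := 1)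
      (fun _ => by rw [abs_one]) x β
  have e : srwTwist d (n + 1) (fun k => Real.cos (k i)) x β
      = srwTwist d (n + 1) (fun k => (1 : ℝ) * Real.cos (k i)) x β :=
    congrArg (fun w => srwTwist d (n + 1) w x β) (funext fun k => (one_mul _).symm)
  rw [e, ← h1, h2]

/-- **`[3]ₙ₊₁ + (d−1)·[1,2]ₙ₊₁ = d·([2]ₙ₊₁ − [2]ₙ)`** (`i ≠ i'`, `d ≥ 2(n+1)+1`):
`Tw^{cos³ k_i}_{n+1}(x;β) + (d−1) Tw^{cos k_i cos² k_{i'}}_{n+1}(x;β) = d · (Tw^{cos² k_i}_{n+1}(x;β) − Tw^{cos² k_i}_n(x;β))`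
(co-factor `cos² k_i`, invariant under the permutations fixing `i`, against `D̂`; then the shift).
[cite: FitznerVanDerHofstad2016NoBLE, (3.34)–(3.36) p. 1071, §5.1.1 (5.5) p. 1090] -/
theorem srwTwist_cos_pow_three_add_eq {n : ℕ} (hd : 2 * (n + 1) + 1 ≤ d) {i i' : Fin d}
    (hii' : i ≠ i') (x : Fin d → ℤ) (β : ℝ) :
    srwTwist d (n + 1) (fun k => Real.cos (k i) ^ 3) x β
        + ((d : ℝ) - 1) * srwTwist d (n + 1) (fun k => Real.cos (k i) * Real.cos (k i') ^ 2) x β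
      = d * (srwTwist d (n + 1) (fun k => Real.cos (k i) ^ 2) x β
          - srwTwist d n (fun k => Real.cos (k i) ^ 2) x β) := by
  have hd0 : (d : ℝ) ≠ 0 := by
    have : 1 ≤ d := by omega
    positivity
  have hu : ∀ σ : Equiv.Perm (Fin d), σ i = i → ∀ k : Fin d → ℝ,
      (fun k : Fin d → ℝ => Real.cos (k i) ^ 2) (k ∘ σ) = (fun k => Real.cos (k i) ^ 2) k := by
    intro σ hσ k
    show Real.cos ((k ∘ σ) i) ^ 2 = Real.cos (k i) ^ 2
    rw [Function.comp_apply, hσ]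
  have hm : Measurable fun k : Fin d → ℝ => Real.cos (k i) ^ 2 :=
    (Real.continuous_cos.measurable.comp (measurable_pi_apply i)).pow_const 2
  have hb : ∀ k : Fin d → ℝ, |Real.cos (k i) ^ 2| ≤ 1 := fun k => by
    rw [abs_pow]; exact pow_le_one₀ (abs_nonneg _) (Real.abs_cos_le_one _)
  -- co-factor `cos² k_i` (invariant under the permutations fixing `i`) against `D̂`
  have h1 : srwTwist d (n + 1) (fun k => Real.cos (k i) ^ 2 * Dhat d k) x β
      = 1 / d * (srwTwist d (n + 1) (fun k => Real.cos (k i) ^ 2 * Real.cos (k i)) x β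
          + ((d : ℝ) - 1) * srwTwist d (n + 1) (fun k => Real.cos (k i) ^ 2 * Real.cos (k i')) x β) :=
    srwTwist_mul_Dhat_eq_marked hd (fun k => Real.cos (k i) ^ 2) hm hb hu hii'.symm x β
  -- the shift
  have h2 : srwTwist d (n + 1) (fun k => Real.cos (k i) ^ 2 * Dhat d k) x β
      = srwTwist d (n + 1) (fun k => Real.cos (k i) ^ 2) x β
          - srwTwist d n (fun k => Real.cos (k i) ^ 2) x β :=
    srwTwist_mul_Dhat_succ_eq_sub hd (fun k => Real.cos (k i) ^ 2) hm hb x β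
  have e3 : srwTwist d (n + 1) (fun k => Real.cos (k i) ^ 2 * Real.cos (k i)) x β
      = srwTwist d (n + 1) (fun k => Real.cos (k i) ^ 3) x β :=
    congrArg (fun w => srwTwist d (n + 1) w x β) (funext fun k => by ring)
  -- the class `[1,2]`: representative `cos k_i cos² k_{i'}` (two-coordinate transport)
  have t : srwTwist d (n + 1) (fun k => (1 : ℝ) * (Real.cos (k i') * Real.cos (k i) ^ 2)) x β
      = srwTwist d (n + 1) (fun k => (1 : ℝ) * (Real.cos (k i) * Real.cos (k i') ^ 2)) x β :=
    srwTwist_transport₂' (n := n + 1) (fun _ : (Fin d → ℝ) => (1 : ℝ)) Real.cos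
      (fun t => Real.cos t ^ 2) (fun _ _ => rfl) (j := i') (j' := i) hii' hii'.symm x β
  have e12 : srwTwist d (n + 1) (fun k => Real.cos (k i) ^ 2 * Real.cos (k i')) x β
      = srwTwist d (n + 1) (fun k => Real.cos (k i) * Real.cos (k i') ^ 2) x β := by
    rw [congrArg (fun w => srwTwist d (n + 1) w x β)
        (show (fun k : Fin d → ℝ => Real.cos (k i) ^ 2 * Real.cos (k i'))
          = fun k => (1 : ℝ) * (Real.cos (k i') * Real.cos (k i) ^ 2) from funext fun k => by ring), t]
    exact congrArg (fun w => srwTwist d (n + 1) w x β) (funext fun k => by ring)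
  rw [e3, e12, h2] at h1
  -- `h1 : A − B = d⁻¹ (T₃ + (d−1) T₁₂)`
  rw [h1, ← mul_assoc, mul_one_div_cancel hd0, one_mul]

/-- **`Tw^{D̂ D̂^{sin}}_{n+1} = d⁻¹ (([0]−[2])ₙ₊₁ − ([0]−[2])ₙ)`** (`d ≥ 2(n+1)+1`): the shifted-order
term of the `KM₂` weight (`M̂² = D̂² − 4 D̂ D̂^{sin} Ĉ + 4 (D̂^{sin})² Ĉ²`) in the EVEN classes `[0] = 1`,
`[2] = cos² k_i` at the orders `n+1` and `n` (`D̂^{sin} = d⁻² Σ_s sin² k_s`, `srwTwist_Dsin_eq_sub`, and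
the shift). [cite: FitznerVanDerHofstad2016NoBLE, §3.3.3 p. 1070, (3.34)–(3.38) p. 1071, §5.1.1 (5.5) p. 1090] -/
theorem srwTwist_Dhat_mul_Dsin_succ_eq_sub {n : ℕ} (hd : 2 * (n + 1) + 1 ≤ d) (i : Fin d)
    (x : Fin d → ℤ) (β : ℝ) :
    srwTwist d (n + 1) (fun k => Dhat d k * Dsin d k) x β
      = 1 / d * ((srwTwist d (n + 1) (fun _ => (1 : ℝ)) x β
            - srwTwist d (n + 1) (fun k => Real.cos (k i) ^ 2) x β)
          - (srwTwist d n (fun _ => (1 : ℝ)) x β - srwTwist d n (fun k => Real.cos (k i) ^ 2) x β)) := by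
  have hd1 : 1 ≤ d := by omega
  have hd1' : (1 : ℝ) ≤ d := by exact_mod_cast hd1
  have hDs : ∀ k : Fin d → ℝ, |Dsin d k| ≤ 1 := fun k => by
    rw [abs_of_nonneg (Dsin_nonneg k)]
    exact (Dsin_le_inv hd1 k).trans (by rw [one_div]; exact inv_le_one_of_one_le₀ hd1')
  have e : srwTwist d (n + 1) (fun k => Dhat d k * Dsin d k) x β
      = srwTwist d (n + 1) (fun k => Dsin d k * Dhat d k) x β :=
    congrArg (fun w => srwTwist d (n + 1) w x β) (funext fun k => mul_comm _ _)
  rw [e, srwTwist_mul_Dhat_succ_eq_sub hd (Dsin d) (continuous_Dsin d).measurable hDs x β,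
    srwTwist_Dsin_eq_sub (by omega) i x β, srwTwist_Dsin_eq_sub (by omega) i x β]
  ring

/-! ### The `KM₂` weight from even classes only -/

/-- **The `KM₂` weight `|D̂|⁰ M̂²` in EVEN product classes** (`i ≠ i'`, `d ≥ 2(n+2)+1`):
`Tw^{|D̂|⁰ M̂²}_n = (d⁻¹ [2]ₙ + ((d−1)/d) [1,1]ₙ) − 4 d⁻¹ (([0]−[2])ₙ₊₁ − ([0]−[2])ₙ)
 + 4 d⁻³ ((([0]−[2]) − ([2]−[4])) + (d−1)(([0]−[2]) − ([2]−[2,2])))ₙ₊₂`, representatives `1`, `cos² k_i`,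
`cos k_i cos k_{i'}`, `cos⁴ k_i`, `cos² k_i cos² k_{i'}` — the odd classes `[1], [3], [1,2]` of
`srwTwist_abs_Dhat_pow_zero_mul_Mhat_sq_eq_classes` do not occur.
[cite: FitznerVanDerHofstad2016NoBLE, §3.3.3 p. 1070, (3.34)–(3.38) p. 1071, §5.2 (5.9), (5.14) p. 1092] -/
theorem srwTwist_abs_Dhat_pow_zero_mul_Mhat_sq_eq_even {n : ℕ} (hd : 2 * (n + 2) + 1 ≤ d)
    {i i' : Fin d} (hii' : i ≠ i') (x : Fin d → ℤ) (β : ℝ) :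
    srwTwist d n (fun k => |Dhat d k| ^ 0 * Mhat d k ^ 2) x β
      = (1 / d * srwTwist d n (fun k => Real.cos (k i) ^ 2) x β
          + ((d : ℝ) - 1) / d * srwTwist d n (fun k => Real.cos (k i) * Real.cos (k i')) x β)
        - 4 * (1 / d * ((srwTwist d (n + 1) (fun _ => (1 : ℝ)) x β
              - srwTwist d (n + 1) (fun k => Real.cos (k i) ^ 2) x β)
            - (srwTwist d n (fun _ => (1 : ℝ)) x β - srwTwist d n (fun k => Real.cos (k i) ^ 2) x β)))
        + 4 * ((1 / (d : ℝ)) ^ 3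
          * (((srwTwist d (n + 2) (fun _ => (1 : ℝ)) x β
                  - srwTwist d (n + 2) (fun k => Real.cos (k i) ^ 2) x β)
                - (srwTwist d (n + 2) (fun k => Real.cos (k i) ^ 2) x β
                  - srwTwist d (n + 2) (fun k => Real.cos (k i) ^ 4) x β))
            + ((d : ℝ) - 1) * ((srwTwist d (n + 2) (fun _ => (1 : ℝ)) x β
                  - srwTwist d (n + 2) (fun k => Real.cos (k i) ^ 2) x β)
                - (srwTwist d (n + 2) (fun k => Real.cos (k i) ^ 2) x β
                  - srwTwist d (n + 2) (fun k => Real.cos (k i) ^ 2 * Real.cos (k i') ^ 2) x β)))) := by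
  have hd2 : 2 * (n + 2) + 1 ≤ d := hd
  have h := srwTwist_abs_Dhat_pow_mul_Mhat_sq_eq_of_even hd x β (l := 0) ⟨0, rfl⟩
  simp only [zero_add, pow_one, pow_zero, one_mul] at h
  simp only [pow_zero, one_mul]
  rw [h, srwTwist_Dhat_sq_eq_classes (by omega) hii' x β,
    srwTwist_Dhat_mul_Dsin_succ_eq_sub (by omega) i x β, srwTwist_Dsin_sq_eq_classes (by omega) hii' x β]
  -- order n+2: the sin classes in pure form
  have hC : srwTwist d (n + 2) (fun k => Real.sin (k i) ^ 4) x β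
      = (srwTwist d (n + 2) (fun _ => (1 : ℝ)) x β - srwTwist d (n + 2) (fun k => Real.cos (k i) ^ 2) x β)
        - (srwTwist d (n + 2) (fun k => Real.cos (k i) ^ 2) x β
          - srwTwist d (n + 2) (fun k => Real.cos (k i) ^ 4) x β) := by
    rw [srwTwist_sin_pow_four_eq (n + 2) i x β, srwTwist_sin_sq_mul_sin_sq_eq hd2 i i x β,
      show (fun k : Fin d → ℝ => Real.cos (k i) ^ 2 * Real.cos (k i) ^ 2) = fun k => Real.cos (k i) ^ 4 from
        funext fun k => by ring]
  have hT : srwTwist d (n + 2) (fun k => Real.cos (k i') ^ 2) x β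
      = srwTwist d (n + 2) (fun k => Real.cos (k i) ^ 2) x β := by
    have t := srwTwist_transport₁' (n := n + 2) (fun _ : (Fin d → ℝ) => (1 : ℝ)) (fun t => Real.cos t ^ 2)
      (fun _ _ => rfl) i i' x β
    simpa only [one_mul] using t
  have hD : srwTwist d (n + 2) (fun k => Real.sin (k i) ^ 2 * Real.sin (k i') ^ 2) x β
      = (srwTwist d (n + 2) (fun _ => (1 : ℝ)) x β - srwTwist d (n + 2) (fun k => Real.cos (k i) ^ 2) x β)
        - (srwTwist d (n + 2) (fun k => Real.cos (k i) ^ 2) x β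
          - srwTwist d (n + 2) (fun k => Real.cos (k i) ^ 2 * Real.cos (k i') ^ 2) x β) := by
    rw [srwTwist_sin_sq_mul_sin_sq_eq hd2 i i' x β, hT,
      show (fun k : Fin d → ℝ => Real.cos (k i') ^ 2 * Real.cos (k i) ^ 2)
        = fun k => Real.cos (k i) ^ 2 * Real.cos (k i') ^ 2 from funext fun k => mul_comm _ _]
  rw [hC, hD]

/-- **Enclosure of `Tw^{|D̂|⁰ M̂²}_n(x;β)` from enclosures of the EVEN classes** `[2]ₙ, [1,1]ₙ, [0]ₙ,
[0]ₙ₊₁, [2]ₙ₊₁, [0]ₙ₊₂, [2]ₙ₊₂, [4]ₙ₊₂, [2,2]ₙ₊₂` (representatives as in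
`srwTwist_abs_Dhat_pow_zero_mul_Mhat_sq_eq_even`; `i ≠ i'`, `d ≥ 2(n+2)+1`): lower / upper bound = the
identity with every difference replaced by the corresponding difference of bounds.
[cite: FitznerVanDerHofstad2016NoBLE, (3.36)–(3.38) p. 1071, §5.2 (5.9), (5.14) p. 1092] -/
theorem srwTwist_abs_Dhat_pow_zero_mul_Mhat_sq_encl_even {n : ℕ} (hd : 2 * (n + 2) + 1 ≤ d)
    {i i' : Fin d} (hii' : i ≠ i') (x : Fin d → ℤ) (β : ℝ)
    {l₂ h₂ l₁₁ h₁₁ l₀ h₀ p₀ P₀ p₂ P₂ m₀ M₀ m₂ M₂ m₄ M₄ m₂₂ M₂₂ : ℝ}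
    (e2 : l₂ ≤ srwTwist d n (fun k => Real.cos (k i) ^ 2) x β
      ∧ srwTwist d n (fun k => Real.cos (k i) ^ 2) x β ≤ h₂)
    (e11 : l₁₁ ≤ srwTwist d n (fun k => Real.cos (k i) * Real.cos (k i')) x β
      ∧ srwTwist d n (fun k => Real.cos (k i) * Real.cos (k i')) x β ≤ h₁₁)
    (e0 : l₀ ≤ srwTwist d n (fun _ => (1 : ℝ)) x β ∧ srwTwist d n (fun _ => (1 : ℝ)) x β ≤ h₀)
    (g0 : p₀ ≤ srwTwist d (n + 1) (fun _ => (1 : ℝ)) x β ∧ srwTwist d (n + 1) (fun _ => (1 : ℝ)) x β ≤ P₀)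
    (g2 : p₂ ≤ srwTwist d (n + 1) (fun k => Real.cos (k i) ^ 2) x β
      ∧ srwTwist d (n + 1) (fun k => Real.cos (k i) ^ 2) x β ≤ P₂)
    (f0 : m₀ ≤ srwTwist d (n + 2) (fun _ => (1 : ℝ)) x β ∧ srwTwist d (n + 2) (fun _ => (1 : ℝ)) x β ≤ M₀)
    (f2 : m₂ ≤ srwTwist d (n + 2) (fun k => Real.cos (k i) ^ 2) x β
      ∧ srwTwist d (n + 2) (fun k => Real.cos (k i) ^ 2) x β ≤ M₂)
    (f4 : m₄ ≤ srwTwist d (n + 2) (fun k => Real.cos (k i) ^ 4) x β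
      ∧ srwTwist d (n + 2) (fun k => Real.cos (k i) ^ 4) x β ≤ M₄)
    (f22 : m₂₂ ≤ srwTwist d (n + 2) (fun k => Real.cos (k i) ^ 2 * Real.cos (k i') ^ 2) x β
      ∧ srwTwist d (n + 2) (fun k => Real.cos (k i) ^ 2 * Real.cos (k i') ^ 2) x β ≤ M₂₂) :
    (1 / d * l₂ + ((d : ℝ) - 1) / d * l₁₁)
        - 4 * (1 / d * (((P₀ - p₂) - (l₀ - h₂))))
        + 4 * ((1 / (d : ℝ)) ^ 3 * (((m₀ - M₂) - (M₂ - m₄)) + ((d : ℝ) - 1) * ((m₀ - M₂) - (M₂ - m₂₂))))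
      ≤ srwTwist d n (fun k => |Dhat d k| ^ 0 * Mhat d k ^ 2) x β
    ∧ srwTwist d n (fun k => |Dhat d k| ^ 0 * Mhat d k ^ 2) x β
      ≤ (1 / d * h₂ + ((d : ℝ) - 1) / d * h₁₁)
        - 4 * (1 / d * (((p₀ - P₂) - (h₀ - l₂))))
        + 4 * ((1 / (d : ℝ)) ^ 3 * (((M₀ - m₂) - (m₂ - M₄)) + ((d : ℝ) - 1) * ((M₀ - m₂) - (m₂ - M₂₂)))) := by
  have hd1 : (1 : ℝ) ≤ d := by exact_mod_cast (show 1 ≤ d by omega)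
  have hc0 : (0 : ℝ) ≤ 1 / d := by positivity
  have hc1 : (0 : ℝ) ≤ (d : ℝ) - 1 := by linarith
  have hc2 : (0 : ℝ) ≤ ((d : ℝ) - 1) / d := div_nonneg hc1 (Nat.cast_nonneg _)
  obtain ⟨e2l, e2h⟩ := e2; obtain ⟨e11l, e11h⟩ := e11; obtain ⟨e0l, e0h⟩ := e0
  obtain ⟨g0l, g0h⟩ := g0; obtain ⟨g2l, g2h⟩ := g2; obtain ⟨f0l, f0h⟩ := f0
  obtain ⟨f2l, f2h⟩ := f2; obtain ⟨f4l, f4h⟩ := f4; obtain ⟨f22l, f22h⟩ := f22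
  rw [srwTwist_abs_Dhat_pow_zero_mul_Mhat_sq_eq_even hd hii' x β]
  constructor <;> gcongr

end Literature.Probability.FitznerVanDerHofstad2017

end
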